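import Summits.HubbardSuperconductivity.HubbardSuperconductivity.Theorems.InfiniteVolumeFirstTightnessExchange

/-!
# Route `InfiniteVolumeFirst` — the exchange lemma with VANISHING-MODE tightness only

Support for crux `NoInfraredPileUp` (stmt-HubbardSuperconductivity-18534), strategist
recommendation R1 of `Cruxes/NoInfraredPileUp/STRATEGY-CENSUS.md` §4/§7 and the typed objects of
`Cruxes/NoInfraredPileUp/StrategistSketch.lean` §D/§R1.

The landed exchange lemma `infiniteVolumeFirst_tightnessExchange_proof` (item 18535) consumes the
tightness of the small-momentum window tails of the `d`-wave pair structure factor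
(`Σ_{m ≠ 0, |q_m| ≤ ε} S_L(m) ≤ η L²` eventually, for every `η` some `ε` — the conclusion of the crux
`NoInfraredPileUp` for the family at hand). Its proof invokes tightness ONLY along a bad
subsequence of even sides on which the long-range-order sequence `LRO_L = S_L(0) / L²` tends to `0`.
Hence the hypothesis can be weakened to the "no sliding condensate" shape (Sub₁ of the census):
for every `η > 0` there are a zero-mode threshold `θ > 0`, a window `ε > 0` and `L₀` such that at
every even side `L ≥ L₀` with a SMALL zero mode, `S_L(0) ≤ θ L²`, the window tail is `≤ η L²`.

* `stub_tightnessExchangeVanishing` — the strengthened exchange lemma (registered stub of 18534);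
* (the landed item 18535, `infiniteVolumeFirst_tightnessExchange_proof`, is the special case
  `θ := 1`; it is not re-proved here);
* `noSlidingCondensate_of_noInfraredPileUp` — the crux implies its load-bearing half Sub₁;
* `hubbardSuperconductivity_of_noSlidingCondensate` — the route's deciding theorem re-glued:
  `NoNormalLimitState → Sub₁ → HubbardSuperconductivity`, now UNCONDITIONAL in the exchange step.

So the route may replace the crux `NoInfraredPileUp` (rank 3) by Sub₁ (phase separation with a
coherent paired component and a generalised condensate COEXISTING with a macroscopic zero mode
leave its refutation surface); the twist wall of `Theorems/NoInfraredPileUp/Negative/*` is unchanged.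

Proof of the main theorem: the landed proof verbatim (Kennedy–Lieb–Shastry Fourier modes and sum
rule; Fröhlich–Simon–Spencer / Dyson–Lieb–Simon momentum-space route to LRO; diagonal compactness in
`[-C_d², C_d²]^{ℤ²}`), with one extra eventuality in Step 4: along the bad subsequence
`u(L_j) → 0`, so eventually `u(L_j) ≤ θ`, i.e. `S_{L_j}(0) = L_j² u(L_j) ≤ θ L_j²`
(`pairStructureFactor_zero`, `torusLROSeq_pairFieldCorr_succ`), which is exactly the side condition
under which the weakened hypothesis delivers the window bound.

Sources: Kennedy–Lieb–Shastry, PRL **61** (1988) 2582; Fröhlich–Simon–Spencer, CMP **50** (1976) 79,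
§3; Dyson–Lieb–Simon, JSP **18** (1978) 335; Friedli–Velenik (2017), §3.7.2 and §10.4.
No definition and no named fact is introduced.
-/

noncomputable section

-- the mandated namespace `Summit.<Summit>.<Problem>.Theorems` repeats `HubbardSuperconductivity`
-- (single-problem summit, D-0017), which the `dupNamespace` linter flags on every declaration
set_option linter.dupNamespace false

namespace Summit.HubbardSuperconductivity.HubbardSuperconductivity.Theorems

open Literature.MathematicalPhysics.QuantumLattice Literature.Probability.LatticeModels Matrix Finset
  Filter
open scoped ComplexConjugate ComplexOrder Topology

/-! ### The zero mode versus the long-range-order sequence -/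

/-- `S_{n+1}(0) = (n+1)² · LRO_{n+1}`: the zero mode of the pair structure factor is `L²` times the
term of side `L = n + 1` of the long-range-order sequence `|Λ_L|⁻² Σ_{x,y ∈ Λ_L} G_L(x,y)`
(both are `re ⟨ψ, Δ_dᴴ Δ_d ψ⟩`, over `L²` and `L⁴` respectively).
Scalapino, Phys. Rep. 250 (1995) 329, §2, eq. (2.4). [folklore] -/
theorem pairStructureFactor_zero_eq_sq_mul_lroSeq (ψ : ∀ L, Fock (Orb (FermionTorus 2 L)))
    (n : ℕ) :
    pairStructureFactor dWaveFormFactor (n + 1) (ψ (n + 1)) 0 =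
      ((n + 1 : ℕ) : ℝ) ^ 2 *
        ((∑ x ∈ halfOpenBox 2 (n + 1), ∑ y ∈ halfOpenBox 2 (n + 1),
            torusPullback (pairFieldCorr dWaveFormFactor ψ) (n + 1) x y) /
          ((halfOpenBox 2 (n + 1)).card : ℝ) ^ 2) := by
  rw [torusLROSeq_pairFieldCorr_succ, pairStructureFactor_zero]
  have hL : ((n + 1 : ℕ) : ℝ) ≠ 0 := by positivity
  field_simp

/-! ### The exchange lemma with vanishing-mode tightness -/

/-- **The Fejér / compactness exchange lemma, vanishing-mode form** (registered stub
`stub_tightnessExchangeVanishing` of crux stmt-HubbardSuperconductivity-18534; strategist R1).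
For any family `ψ` of torus vectors normalised at even sides: if for every `η > 0` there are
`θ, ε > 0` and `L₀` such that at every even side `L ≥ L₀` WITH `S_L(0) ≤ θ L²` the window tail
`Σ_{m ≠ 0, |q_m| ≤ ε} S_L(m)` is at most `η L²`, and every pointwise subsequential limit (along even
sides) of the translation-averaged pair correlations has a positive condensate atom, then the
`d`-wave pair field has long-range order along the even sides in the summit's format.
Proof: as `infiniteVolumeFirst_tightnessExchange_proof`; the window bound is needed only along the
bad subsequence `LRO_{L_j} → 0`, where eventually `LRO_{L_j} ≤ θ`, i.e. `S_{L_j}(0) ≤ θ L_j²`.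
Kennedy–Lieb–Shastry, PRL 61 (1988) 2582; Fröhlich–Simon–Spencer (1976) §3; Friedli–Velenik (2017)
§3.7.2, §10.4. [folklore] -/
theorem stub_tightnessExchangeVanishing :
    ∀ (ψ : ∀ L, Fock (Orb (FermionTorus 2 L))), (∀ L, Even L → star (ψ L) ⬝ᵥ ψ L = 1) →
    (∀ η : ℝ, 0 < η → ∃ θ : ℝ, 0 < θ ∧ ∃ ε : ℝ, 0 < ε ∧ ∃ L₀ : ℕ, ∀ (L : ℕ) [NeZero L],
        Even L → L₀ ≤ L → pairStructureFactor dWaveFormFactor L (ψ L) 0 ≤ θ * (L : ℝ) ^ 2 →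
          (∑ m : Fin 2 → ZMod L, if m ≠ 0 ∧ momentumNormSq L m ≤ ε ^ 2 then
              pairStructureFactor dWaveFormFactor L (ψ L) m else 0) ≤ η * (L : ℝ) ^ 2) →
      (∀ (Ls : ℕ → ℕ) (C : Site 2 → ℝ), StrictMono Ls → (∀ j, Even (Ls j)) →
          (∀ x : Site 2, Tendsto (fun j : ℕ => (∑ y ∈ halfOpenBox 2 (Ls j),
              torusPullback (pairFieldCorr dWaveFormFactor ψ) (Ls j) (x + y) y) / ((Ls j : ℕ) : ℝ) ^ 2)
            atTop (nhds (C x))) →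
            0 < liminf (fun R : ℕ => (∑ x ∈ halfOpenBox 2 R, ∑ y ∈ halfOpenBox 2 R, C (x - y)) /
              ((R : ℕ) : ℝ) ^ 4) atTop) →
        HasLongRangeOrder (fun k => halfOpenBox 2 (2 * k))
          (fun k => torusPullback (pairFieldCorr dWaveFormFactor ψ) (2 * k)) := by
  intro ψ hnorm htight hatom
  -- the constant `C_d²`
  obtain ⟨B, hB⟩ : ∃ B : ℝ, B = (∑ e ∈ insert (0 : Site 2) unitSteps,
      ‖((dWaveFormFactor e / Real.sqrt 2 : ℝ) : ℂ)‖ * 2) ^ 2 := ⟨_, rfl⟩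
  have hB0 : 0 ≤ B := by rw [hB]; positivity
  -- the long-range-order sequence
  obtain ⟨u, hu⟩ : ∃ u : ℕ → ℝ, ∀ L, u L = (∑ x ∈ halfOpenBox 2 L, ∑ y ∈ halfOpenBox 2 L,
      torusPullback (pairFieldCorr dWaveFormFactor ψ) L x y) / ((halfOpenBox 2 L).card : ℝ) ^ 2 :=
    ⟨_, fun _ => rfl⟩
  -- the translation-averaged pair correlations
  obtain ⟨Cavg, hCavg⟩ : ∃ Cavg : ℕ → Site 2 → ℝ, ∀ L x, Cavg L x =
      (∑ y ∈ halfOpenBox 2 L, torusPullback (pairFieldCorr dWaveFormFactor ψ) L (x + y) y) /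
        ((L : ℕ) : ℝ) ^ 2 := ⟨_, fun _ _ => rfl⟩
  have hgoal : HasLongRangeOrder (fun k => halfOpenBox 2 (2 * k))
      (fun k => torusPullback (pairFieldCorr dWaveFormFactor ψ) (2 * k)) ↔
      0 < liminf (fun k => u (2 * k)) atTop := by
    simp only [HasLongRangeOrder, hu]
  rw [hgoal]
  by_contra hneg
  have hlim0 : liminf (fun k => u (2 * k)) atTop ≤ 0 := not_lt.1 hneg
  -- a priori bounds at the even sides
  have hu0 : ∀ k, 0 ≤ u (2 * k) := fun k => by
    rw [hu]; exact tightnessExchange_lroSeq_nonneg ψ _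
  have huB : ∀ k, u (2 * k) ≤ B := fun k => by
    rw [hu, hB]; exact tightnessExchange_lroSeq_le ψ _ (hnorm _ (even_two_mul k))
  have hCB : ∀ k x, |Cavg (2 * k) x| ≤ B := fun k x => by
    rw [hCavg, hB]; exact tightnessExchange_abs_corrAvg_le ψ _ (hnorm _ (even_two_mul k)) x
  -- Step 1: a subsequence of even sides along which the LRO sequence tends to `0`
  have hfreq : ∀ N : ℕ, ∃ᶠ k in atTop, u (2 * k) < 1 / ((N : ℝ) + 1) := fun N =>
    frequently_lt_of_liminf_lt (isCoboundedUnder_ge_of_le atTop huB)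
      (hlim0.trans_lt (by positivity))
  obtain ⟨φ₁, hφ₁, hφ₁u⟩ := extraction_forall_of_frequently hfreq
  have hu_tend : Tendsto (fun j => u (2 * φ₁ j)) atTop (𝓝 0) :=
    tendsto_of_tendsto_of_tendsto_of_le_of_le tendsto_const_nhds
      tendsto_one_div_add_atTop_nhds_zero_nat (fun j => hu0 _) (fun j => (hφ₁u j).le)
  -- Step 2: a further subsequence along which `C_L` converges pointwise (diagonal argument)
  obtain ⟨K, hK⟩ : ∃ K : Set (Site 2 → ℝ), K = Set.pi Set.univ fun _ => Set.Icc (-B) B :=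
    ⟨_, rfl⟩
  have hKc : IsCompact K := hK ▸ isCompact_univ_pi fun _ => isCompact_Icc
  have hmem : ∀ j, (fun x => Cavg (2 * φ₁ j) x) ∈ K := fun j =>
    hK ▸ Set.mem_univ_pi.2 fun x => abs_le.1 (hCB _ x)
  obtain ⟨C, hCK, φ₂, hφ₂, hconv⟩ := hKc.tendsto_subseq hmem
  rw [hK] at hCK
  have hCbd : ∀ x, |C x| ≤ B := fun x => abs_le.2 (Set.mem_univ_pi.1 hCK x)
  -- the subsequence of sides
  obtain ⟨Ls, hLs⟩ : ∃ Ls : ℕ → ℕ, ∀ j, Ls j = 2 * φ₁ (φ₂ j) := ⟨_, fun _ => rfl⟩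
  have hLs_mono : StrictMono Ls := fun a b hab => by
    have h := hφ₁ (hφ₂ hab)
    rw [hLs, hLs]
    omega
  have hLs_even : ∀ j, Even (Ls j) := fun j => hLs j ▸ even_two_mul _
  have hLs_conv : ∀ x : Site 2, Tendsto (fun j => Cavg (Ls j) x) atTop (𝓝 (C x)) := fun x =>
    (tendsto_pi_nhds.1 hconv x).congr fun j => by simp only [Function.comp_apply, hLs]
  have hu_tend' : Tendsto (fun j => u (Ls j)) atTop (𝓝 0) :=
    (hu_tend.comp hφ₂.tendsto_atTop).congr fun j => by simp only [Function.comp_apply, hLs]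
  -- Step 3: the atom of the limit
  obtain ⟨b, hb⟩ : ∃ b : ℕ → ℝ, ∀ R, b R = (∑ x ∈ halfOpenBox 2 R, ∑ y ∈ halfOpenBox 2 R,
      C (x - y)) / ((R : ℕ) : ℝ) ^ 4 := ⟨_, fun _ => rfl⟩
  have hatomC : 0 < liminf b atTop := by
    have h := hatom Ls C hLs_mono hLs_even (fun x => by simpa only [hCavg] using hLs_conv x)
    have hfun : (fun R : ℕ => (∑ x ∈ halfOpenBox 2 R, ∑ y ∈ halfOpenBox 2 R, C (x - y)) /
        ((R : ℕ) : ℝ) ^ 4) = b := funext fun R => (hb R).symm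
    rwa [hfun] at h
  have hb_low : ∀ R, -B ≤ b R := by
    intro R
    have habs : |b R| ≤ B := by
      rw [hb, abs_div, abs_of_nonneg (by positivity : (0 : ℝ) ≤ ((R : ℕ) : ℝ) ^ 4)]
      rcases Nat.eq_zero_or_pos R with rfl | hRpos
      · simpa using hB0
      · rw [div_le_iff₀ (by positivity)]
        calc |∑ x ∈ halfOpenBox 2 R, ∑ y ∈ halfOpenBox 2 R, C (x - y)|
            ≤ ∑ x ∈ halfOpenBox 2 R, |∑ y ∈ halfOpenBox 2 R, C (x - y)| :=
              Finset.abs_sum_le_sum_abs _ _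
          _ ≤ ∑ x ∈ halfOpenBox 2 R, ∑ y ∈ halfOpenBox 2 R, |C (x - y)| :=
              Finset.sum_le_sum fun x _ => Finset.abs_sum_le_sum_abs _ _
          _ ≤ ∑ x ∈ halfOpenBox 2 R, ∑ y ∈ halfOpenBox 2 R, B :=
              Finset.sum_le_sum fun x _ => Finset.sum_le_sum fun y _ => hCbd _
          _ = B * ((R : ℕ) : ℝ) ^ 4 := by
              rw [Finset.sum_const, Finset.sum_const, card_halfOpenBox, smul_smul, nsmul_eq_mul]
              push_cast
              ring
    exact (abs_le.1 habs).1
  -- Step 4: for every `η > 0` the atom is at most `2η`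
  have hkey : ∀ η : ℝ, 0 < η → liminf b atTop ≤ 2 * η := by
    intro η hη
    obtain ⟨θ, hθ, ε, hε, L₀, hL₀⟩ := htight η hη
    -- NEW (vanishing-mode form): along the bad subsequence the zero mode is eventually small
    have hsmall : ∀ᶠ j in atTop, u (Ls j) ≤ θ :=
      (hu_tend'.eventually (Iic_mem_nhds hθ)).mono fun j hj => hj
    -- the Fejér bound in the limit `j → ∞`, at every block scale `R > 0`
    have hR : ∀ R : ℕ, 0 < R → b R ≤ η + 2 * Real.pi ^ 2 * B / ((R : ℝ) ^ 2 * ε ^ 2) := by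
      intro R hRpos
      have hbj : Tendsto (fun j => (∑ x ∈ halfOpenBox 2 R, ∑ y ∈ halfOpenBox 2 R,
          Cavg (Ls j) (x - y)) / ((R : ℕ) : ℝ) ^ 4) atTop (𝓝 (b R)) := by
        rw [hb]
        exact (tendsto_finsetSum _ fun x _ => tendsto_finsetSum _ fun y _ =>
          hLs_conv (x - y)).div_const _
      have huj : Tendsto (fun j => u (Ls j) + η + 2 * Real.pi ^ 2 * B / ((R : ℝ) ^ 2 * ε ^ 2))
          atTop (𝓝 (0 + η + 2 * Real.pi ^ 2 * B / ((R : ℝ) ^ 2 * ε ^ 2))) :=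
        (hu_tend'.add_const _).add_const _
      rw [zero_add] at huj
      refine le_of_tendsto_of_tendsto hbj huj ?_
      have hev : ∀ᶠ j in atTop, max L₀ 1 ≤ Ls j := hLs_mono.tendsto_atTop.eventually_ge_atTop _
      filter_upwards [hev, hsmall] with j hj hjθ
      obtain ⟨n, hn⟩ : ∃ n, Ls j = n + 1 := ⟨Ls j - 1, by omega⟩
      have hevn : Even (n + 1) := hn ▸ hLs_even j
      have hψn : star (ψ (n + 1)) ⬝ᵥ ψ (n + 1) = 1 := hnorm (n + 1) hevn
      -- the side condition `S_{n+1}(0) ≤ θ (n+1)²` of the weakened hypothesis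
      have hzero : pairStructureFactor dWaveFormFactor (n + 1) (ψ (n + 1)) 0 ≤
          θ * ((n + 1 : ℕ) : ℝ) ^ 2 := by
        rw [pairStructureFactor_zero_eq_sq_mul_lroSeq, ← hu, ← hn, mul_comm]
        exact mul_le_mul_of_nonneg_right hjθ (sq_nonneg _)
      have hwin := hL₀ (n + 1) hevn (by omega) hzero
      have hwin' : (∑ m : TorusSite 2 (n + 1), if m ≠ 0 ∧ momentumNormSq (n + 1) m ≤ ε ^ 2 then
          pairStructureFactor dWaveFormFactor (n + 1) (ψ (n + 1)) m else 0) /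
            ((n + 1 : ℕ) : ℝ) ^ 2 ≤ η := by rwa [div_le_iff₀ (by positivity)]
      have hf := tightnessExchange_fejer_bound ψ n hψn R hRpos ε hε
      rw [← hB, ← hu] at hf
      rw [hn]
      simp only [hCavg]
      linarith
    -- hence eventually `b R ≤ 2η`
    have htail : Tendsto (fun R : ℕ => 2 * Real.pi ^ 2 * B / ((R : ℝ) ^ 2 * ε ^ 2)) atTop
        (𝓝 0) := by
      refine tendsto_const_nhds.div_atTop ?_
      exact ((tendsto_pow_atTop two_ne_zero).comp tendsto_natCast_atTop_atTop).atTop_mul_const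
        (pow_pos hε 2)
    have hev : ∀ᶠ R : ℕ in atTop, b R ≤ 2 * η := by
      filter_upwards [htail.eventually_le_const hη, eventually_gt_atTop 0] with R h1 h2
      linarith [hR R h2]
    exact liminf_le_of_frequently_le hev.frequently (isBoundedUnder_of ⟨-B, fun R => hb_low R⟩)
  have h := hkey (liminf b atTop / 4) (by positivity)
  linarith

/-! ### Comparison with the landed items

The landed exchange lemma (item stmt-HubbardSuperconductivity-18535, `TightnessExchange`,
`infiniteVolumeFirst_tightnessExchange_proof`) is the special case of
`stub_tightnessExchangeVanishing` in which the window bound holds regardless of the size of the zero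
mode (`θ := 1`); being landed, it is not restated here. -/

/-- The crux `NoInfraredPileUp` implies its load-bearing half Sub₁ "no sliding condensate"
(`Cruxes/NoInfraredPileUp/StrategistSketch.lean` §D, spelled out): the window bound of the crux holds
at every large even side, in particular at those with a small zero mode. [folklore] -/
theorem noSlidingCondensate_of_noInfraredPileUp
    (h : Summit.HubbardSuperconductivity.HubbardSuperconductivity.Theses.InfiniteVolumeFirst.NoInfraredPileUp) :
    ∀ δ ∈ Set.Ioo (0:ℝ) (1 / 2), ∃ U₁ : ℝ, 0 < U₁ ∧ ∀ U ∈ Set.Ioo (0:ℝ) U₁,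
      ∀ (N : ℕ → ℕ) (ψ : ∀ L, Fock (Orb (FermionTorus 2 L))),
        (∀ L, Even L → N L = 2 * ⌊(1 - δ) * (L : ℝ) ^ 2 / 2⌋₊ ∧ star (ψ L) ⬝ᵥ ψ L = 1 ∧
            IsGroundStateInSector (hubbardTorus 2 L 1 U) (N L) 0 (ψ L)) →
          ∀ η : ℝ, 0 < η → ∃ θ : ℝ, 0 < θ ∧ ∃ ε : ℝ, 0 < ε ∧ ∃ L₀ : ℕ, ∀ (L : ℕ) [NeZero L],
            Even L → L₀ ≤ L →
              pairStructureFactor dWaveFormFactor L (ψ L) 0 ≤ θ * (L : ℝ) ^ 2 →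
                (∑ m : Fin 2 → ZMod L, if m ≠ 0 ∧ momentumNormSq L m ≤ ε ^ 2 then
                    pairStructureFactor dWaveFormFactor L (ψ L) m else 0) ≤ η * (L : ℝ) ^ 2 := by
  intro δ hδ
  obtain ⟨U₁, hU₁, h'⟩ := h δ hδ
  refine ⟨U₁, hU₁, fun U hU N ψ hadm η hη => ?_⟩
  obtain ⟨ε, hε, L₀, hL₀⟩ := h' U hU N ψ hadm η hη
  exact ⟨1, one_pos, ε, hε, L₀, fun L _ hL hLL _ => hL₀ L hL hLL⟩

/-- **The route's deciding theorem re-glued on Sub₁** (strategist R1, now unconditional in the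
exchange step): `NoNormalLimitState` (crux stmt-18533) together with "no sliding condensate at weak
coupling" (Sub₁ of crux stmt-18534, spelled out) already gives the summit — the exchange lemma
needed is `stub_tightnessExchangeVanishing`, proved above. Same five lines of logic as the landed
`infiniteVolumeFirst_assembly_proof`: `NoNormalLimitState` supplies `δ`, Sub₁ at `δ` supplies `U₁`,
`NoNormalLimitState` at `U₀ := U₁` supplies `U ∈ (0,U₁)` and the atom of every limit of every
admissible family, Sub₁ the vanishing-mode tightness of that family, and the exchange lemma the
long-range order. Koma–Tasaki (1994) (LRO format); Scalapino, Phys. Rep. 250 (1995) §2. [folklore] -/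
theorem hubbardSuperconductivity_of_noSlidingCondensate
    (h1 : Summit.HubbardSuperconductivity.HubbardSuperconductivity.Theses.InfiniteVolumeFirst.NoNormalLimitState)
    (h2 : ∀ δ ∈ Set.Ioo (0:ℝ) (1 / 2), ∃ U₁ : ℝ, 0 < U₁ ∧ ∀ U ∈ Set.Ioo (0:ℝ) U₁,
      ∀ (N : ℕ → ℕ) (ψ : ∀ L, Fock (Orb (FermionTorus 2 L))),
        (∀ L, Even L → N L = 2 * ⌊(1 - δ) * (L : ℝ) ^ 2 / 2⌋₊ ∧ star (ψ L) ⬝ᵥ ψ L = 1 ∧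
            IsGroundStateInSector (hubbardTorus 2 L 1 U) (N L) 0 (ψ L)) →
          ∀ η : ℝ, 0 < η → ∃ θ : ℝ, 0 < θ ∧ ∃ ε : ℝ, 0 < ε ∧ ∃ L₀ : ℕ, ∀ (L : ℕ) [NeZero L],
            Even L → L₀ ≤ L →
              pairStructureFactor dWaveFormFactor L (ψ L) 0 ≤ θ * (L : ℝ) ^ 2 →
                (∑ m : Fin 2 → ZMod L, if m ≠ 0 ∧ momentumNormSq L m ≤ ε ^ 2 then
                    pairStructureFactor dWaveFormFactor L (ψ L) m else 0) ≤ η * (L : ℝ) ^ 2) :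
    _root_.HubbardSuperconductivity := by
  obtain ⟨δ, hδ, h1'⟩ := h1
  obtain ⟨U₁, hU₁, h2'⟩ := h2 δ hδ
  obtain ⟨U, hU, hA⟩ := h1' U₁ hU₁
  refine ⟨U, hU.1, δ, hδ, fun N ψ hadm => ?_⟩
  exact stub_tightnessExchangeVanishing ψ (fun L hL => (hadm L hL).2.1) (h2' U hU N ψ hadm)
    (hA N ψ hadm)

/-- The two cruxes alone give the summit: the route's `Assembly`
(`NoNormalLimitState → NoInfraredPileUp → TightnessExchange → HubbardSuperconductivity`) with its
third hypothesis discharged, factored through Sub₁ (`noSlidingCondensate_of_noInfraredPileUp`,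
`hubbardSuperconductivity_of_noSlidingCondensate`). [folklore] -/
theorem hubbardSuperconductivity_of_infiniteVolumeFirst_cruxes
    (h1 : Summit.HubbardSuperconductivity.HubbardSuperconductivity.Theses.InfiniteVolumeFirst.NoNormalLimitState)
    (h2 : Summit.HubbardSuperconductivity.HubbardSuperconductivity.Theses.InfiniteVolumeFirst.NoInfraredPileUp) :
    _root_.HubbardSuperconductivity :=
  hubbardSuperconductivity_of_noSlidingCondensate h1 (noSlidingCondensate_of_noInfraredPileUp h2)

end Summit.HubbardSuperconductivity.HubbardSuperconductivity.Theorems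

end
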